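import Mathlib
import Literature.Combinatorics.Additive.ArithmeticRemovalProofs
import Literature.Computability.AlgebraicComplexity.SimultaneousDoubleProduct
import Summits.MatrixMultiplication.MatrixMultiplication.Theses.FourierTwoFamiliesModP

/-!
# `RemovalRegime` — density decay of balanced SDPP families in the regime `n ≤ K s`

Route `MatrixMultiplication/FourierTwoFamiliesModP`, item `stmt-MatrixMultiplication-14314` (support):
for every `K` and `ε > 0` there is `s₀` such that every family of `n` pairs `(A i, B i)` of `s`-subsets,
`s ≥ s₀`, `n ≤ K s`, of a finite abelian group `H` with the simultaneous double product property —
(W) `a, a' ∈ A i`, `b, b' ∈ B i`, `(a - a') + (b - b') = 0 ⇒ a = a' ∧ b = b'` and (X) `a ∈ A i`,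
`a' ∈ A j`, `b ∈ B j`, `b' ∈ B k`, `(a - a') + (b - b') = 0 ⇒ i = k` — has `n s ≤ ε |H|`.

Proof (Green's arithmetic removal lemma with `k = 3`, the tree THEOREM
`Literature.Combinatorics.Additive.Green2005_1_5_holds`; the derivation is grounder g14-11's, as filed
with the item).  Put `X = ⋃ A i`, `Y = ⋃ B i`, `X₀ = ⋃ (A i - B i)`, `N = |H|`.

* Faithfulness (`card_zeroSum_le_card_pairs`): by (X) the zero-sum triples of `X ×ˢ (-Y) ×ˢ (-X₀)`
  inject into the matched pairs `⋃ (A i ×ˢ B i)`, so there are at most `n s²` of them; the `A i` are pairwise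
  disjoint (`n s ≤ N`) and `s² ≤ N` by (W), whence `n s² ≤ N s ≤ δ N²` as soon as `s ≥ 1/δ`.
* Removal: `Green2005_1_5_holds` deletes `≤ η N` elements from each of `X`, `-Y`, `-X₀` and kills every
  zero-sum triple.
* Bookkeeping (`bookkeeping`): every matched pair `(a, b) ∈ A i ×ˢ B i` is the trace of the zero-sum
  triple `(a, -b, b - a)`, so `a` was deleted from `X`, or `-b` from `-Y`, or `b - a` from `-X₀`.  A
  deleted point of `X` (resp. of `-Y`) lies in exactly `s` matched pairs, the blocks being disjoint,
  and a deleted element of `-X₀` lies in at most ONE matched pair per block, the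
  difference map being injective on `A i ×ˢ B i` by (W) (`card_filter_sub_mem_le`), i.e. in at most
  `n` matched pairs.  Hence `n s² ≤ η N (s + s + n)`.
* Arithmetic: with `K⁺ = max K 0` and `n ≤ K s ≤ K⁺ s`, `n s² ≤ η (2 + K⁺) N s`, i.e.
  `n s ≤ η (2 + K⁺) N = ε N` for the choice `η = ε / (2 + K⁺)`.

The threshold `s₀ = ⌈1/δ(η)⌉₊ + 1` is of tower type (Szemerédi regularity inside
`Green2005_1_5_holds`).  The injection `card_zeroSum_le_card_pairs` and the shape of `bookkeeping` are
adapted from the crux-line file `Theorems/FourierTwoFamiliesModPPrimeDensityDecayStubMassConcentration.lean`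
(`card_solutions_le`, `mass_bound` there), which performs the same removal step for `ZMod p` and whose
module could not be imported when this file was written (no hub olean).
-/

-- single-conjunct summit: the mandated namespace repeats `MatrixMultiplication`.
set_option linter.dupNamespace false

namespace Summit.MatrixMultiplication.MatrixMultiplication.Theorems

open scoped BigOperators Pointwise
open Literature.Computability.AlgebraicComplexity

namespace RemovalRegime

-- adapted from Theorems/FourierTwoFamiliesModPPrimeDensityDecayStubMassConcentration.lean
-- (`card_solutions_le`: same injection, stated there with the bound `Σ |A i| |B i|`)
/-- **Faithfulness: zero-sum triples inject into matched pairs.** Under simultaneity (X), the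
zero-sum triples of `X ×ˢ (-Y) ×ˢ (-X₀)` (as `Fin 3`-tuples) inject, via `a ↦ (a 0, -a 1)`, into the
set of matched pairs `⋃ (A i ×ˢ B i)`: if `x ∈ A i`, `y ∈ B k` and `x - y = a' - b'` with `a' ∈ A j`,
`b' ∈ B j`, then `(x - a') + (b' - y) = 0` and (X) gives `i = k`.  Hence there are at most
`|⋃ (A i ×ˢ B i)|` zero-sum triples. -/
theorem card_zeroSum_le_card_pairs {G : Type*} [AddCommGroup G] [DecidableEq G] {n : ℕ}
    (A B : Fin n → Finset G)
    (hX : ∀ i j k : Fin n, ∀ a ∈ A i, ∀ a' ∈ A j, ∀ b ∈ B j, ∀ b' ∈ B k,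
      (a - a') + (b - b') = 0 → i = k) :
    ((Fintype.piFinset ![Finset.univ.biUnion A, -(Finset.univ.biUnion B),
        -(Finset.univ.biUnion fun i => A i - B i)]).filter fun a => ∑ j, a j = 0).card ≤
      (Finset.univ.biUnion fun i => A i ×ˢ B i).card := by
  refine Finset.card_le_card_of_injOn (fun a => (a 0, -a 1)) ?_ ?_
  · intro a ha
    obtain ⟨hmem, hsum⟩ := Finset.mem_filter.1 (Finset.mem_coe.1 ha)
    rw [Fintype.mem_piFinset] at hmem
    rw [Fin.sum_univ_three] at hsum
    have h0 : a 0 ∈ Finset.univ.biUnion A := hmem 0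
    have h1 : a 1 ∈ -(Finset.univ.biUnion B) := hmem 1
    have h2 : a 2 ∈ -(Finset.univ.biUnion fun i => A i - B i) := hmem 2
    rw [Finset.mem_neg', Finset.mem_biUnion] at h1 h2
    obtain ⟨i, -, hi⟩ := Finset.mem_biUnion.1 h0
    obtain ⟨k, -, hk⟩ := h1
    obtain ⟨j, -, hj⟩ := h2
    obtain ⟨a', ha', b', hb', he⟩ := Finset.mem_sub.1 hj
    have hik : i = k := hX i j k (a 0) hi a' ha' b' hb' (-a 1) hk (by
      calc a 0 - a' + (b' - -a 1) = (a 0 + a 1 + a 2) - (a' - b') - a 2 := by abel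
        _ = 0 := by rw [hsum, he]; abel)
    subst hik
    exact Finset.mem_coe.2
      (Finset.mem_biUnion.2 ⟨i, Finset.mem_univ _, Finset.mem_product.2 ⟨hi, hk⟩⟩)
  · intro a ha a' ha' h
    obtain ⟨-, hs⟩ := Finset.mem_filter.1 (Finset.mem_coe.1 ha)
    obtain ⟨-, hs'⟩ := Finset.mem_filter.1 (Finset.mem_coe.1 ha')
    simp only [Prod.mk.injEq, neg_inj] at h
    rw [Fin.sum_univ_three] at hs hs'
    have h2 : a 2 = a' 2 := by
      have e := hs.trans hs'.symm
      rwa [h.1, h.2, add_left_cancel_iff] at e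
    funext j
    fin_cases j
    exacts [h.1, h.2, h2]

/-- **A set of differences meets each block at most once per element.** If the pair `(S, T)` has the
double product property (W), then `(a, b) ↦ b - a` is injective on `S ×ˢ T`, so for every set `R` at
most `|R|` pairs of `S ×ˢ T` have `b - a ∈ R`. -/
theorem card_filter_sub_mem_le {G : Type*} [AddCommGroup G] [DecidableEq G] (S T R : Finset G)
    (hW : ∀ a ∈ S, ∀ a' ∈ S, ∀ b ∈ T, ∀ b' ∈ T, (a - a') + (b - b') = 0 → a = a' ∧ b = b') :
    ((S ×ˢ T).filter fun q : G × G => q.2 - q.1 ∈ R).card ≤ R.card := by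
  refine Finset.card_le_card_of_injOn (fun q : G × G => q.2 - q.1) ?_ ?_
  · intro q hq
    exact Finset.mem_coe.2 (Finset.mem_filter.1 (Finset.mem_coe.1 hq)).2
  · intro p hp q hq hpq
    have hp' := Finset.mem_product.1 (Finset.mem_filter.1 (Finset.mem_coe.1 hp)).1
    have hq' := Finset.mem_product.1 (Finset.mem_filter.1 (Finset.mem_coe.1 hq)).1
    have hpq' : p.2 - p.1 = q.2 - q.1 := hpq
    have h0 : (q.1 - p.1) + (p.2 - q.2) = 0 := by
      calc (q.1 - p.1) + (p.2 - q.2) = (p.2 - p.1) - (q.2 - q.1) := by abel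
        _ = 0 := sub_eq_zero.2 hpq'
    obtain ⟨h1, h2⟩ := hW q.1 hq'.1 p.1 hp'.1 p.2 hp'.2 q.2 hq'.2 h0
    exact Prod.ext h1.symm h2

/-- **One block of the bookkeeping.** If `(S, T)` has (W) and every pair `(a, b) ∈ S ×ˢ T` has
`a ∈ D₀`, `b ∈ D₁` or `b - a ∈ D₂`, then `|S| |T| ≤ |T| |S ∩ D₀| + |S| |T ∩ D₁| + |D₂|`. -/
theorem block_le {G : Type*} [AddCommGroup G] [DecidableEq G] (S T D₀ D₁ D₂ : Finset G)
    (hW : ∀ a ∈ S, ∀ a' ∈ S, ∀ b ∈ T, ∀ b' ∈ T, (a - a') + (b - b') = 0 → a = a' ∧ b = b')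
    (h : ∀ a ∈ S, ∀ b ∈ T, a ∈ D₀ ∨ b ∈ D₁ ∨ b - a ∈ D₂) :
    S.card * T.card ≤ T.card * (S ∩ D₀).card + S.card * (T ∩ D₁).card + D₂.card := by
  calc S.card * T.card = (S ×ˢ T).card := (Finset.card_product S T).symm
    _ ≤ ((S ∩ D₀) ×ˢ T ∪ S ×ˢ (T ∩ D₁) ∪
          (S ×ˢ T).filter fun q : G × G => q.2 - q.1 ∈ D₂).card := by
        refine Finset.card_le_card fun q hq => ?_
        have hq' := Finset.mem_product.1 hq
        rcases h q.1 hq'.1 q.2 hq'.2 with h1 | h2 | h3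
        · exact Finset.mem_union_left _ (Finset.mem_union_left _
            (Finset.mem_product.2 ⟨Finset.mem_inter.2 ⟨hq'.1, h1⟩, hq'.2⟩))
        · exact Finset.mem_union_left _ (Finset.mem_union_right _
            (Finset.mem_product.2 ⟨hq'.1, Finset.mem_inter.2 ⟨hq'.2, h2⟩⟩))
        · exact Finset.mem_union_right _ (Finset.mem_filter.2 ⟨hq, h3⟩)
    _ ≤ ((S ∩ D₀) ×ˢ T).card + (S ×ˢ (T ∩ D₁)).card +
          ((S ×ˢ T).filter fun q : G × G => q.2 - q.1 ∈ D₂).card :=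
        (Finset.card_union_le _ _).trans (Nat.add_le_add_right (Finset.card_union_le _ _) _)
    _ = T.card * (S ∩ D₀).card + S.card * (T ∩ D₁).card +
          ((S ×ˢ T).filter fun q : G × G => q.2 - q.1 ∈ D₂).card := by
        rw [Finset.card_product, Finset.card_product, Nat.mul_comm (S ∩ D₀).card T.card]
    _ ≤ T.card * (S ∩ D₀).card + S.card * (T ∩ D₁).card + D₂.card :=
        Nat.add_le_add_left (card_filter_sub_mem_le S T D₂ hW) _

/-- **The bookkeeping, in `ℕ`.** Let the `A i` be pairwise disjoint `s`-sets, the `B i` pairwise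
disjoint `s`-sets, (W) hold in every block, and let `A' 0 ⊆ X`, `A' 1 ⊆ -Y`, `A' 2 ⊆ -X₀` (any three
sets, in fact) carry no zero-sum triple.  Every matched pair `(a, b) ∈ A i ×ˢ B i` gives the zero-sum
triple `(a, -b, b - a)` of `X ×ˢ (-Y) ×ˢ (-X₀)`, so `a ∈ X \ A' 0`, or `-b ∈ (-Y) \ A' 1`, or
`b - a ∈ (-X₀) \ A' 2`; summing `block_le` over the blocks gives
`n s² ≤ s |X \ A' 0| + s |(-Y) \ A' 1| + n |(-X₀) \ A' 2|`. -/
theorem bookkeeping {G : Type*} [AddCommGroup G] [DecidableEq G] {n s : ℕ}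
    (A B : Fin n → Finset G) (hcard : ∀ i : Fin n, (A i).card = s ∧ (B i).card = s)
    (hW : ∀ i : Fin n, ∀ a ∈ A i, ∀ a' ∈ A i, ∀ b ∈ B i, ∀ b' ∈ B i,
      (a - a') + (b - b') = 0 → a = a' ∧ b = b')
    (hdA : ∀ i j : Fin n, i ≠ j → Disjoint (A i) (A j))
    (hdB : ∀ i j : Fin n, i ≠ j → Disjoint (B i) (B j))
    (A' : Fin 3 → Finset G) (hno : ∀ a ∈ Fintype.piFinset A', ∑ j, a j ≠ 0) :
    n * (s * s) ≤ s * (Finset.univ.biUnion A \ A' 0).card +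
      s * ((-(Finset.univ.biUnion B)) \ A' 1).card +
      n * ((-(Finset.univ.biUnion fun i => A i - B i)) \ A' 2).card := by
  set D₀ := Finset.univ.biUnion A \ A' 0
  set D₁ := (-(Finset.univ.biUnion B)) \ A' 1
  set D₂ := (-(Finset.univ.biUnion fun i => A i - B i)) \ A' 2
  have htri : ∀ i, ∀ a ∈ A i, ∀ b ∈ B i, a ∈ D₀ ∨ b ∈ -D₁ ∨ b - a ∈ D₂ := by
    intro i a ha b hb
    by_contra hne
    simp only [not_or] at hne
    obtain ⟨h0, h1, h2⟩ := hne
    have haX : a ∈ Finset.univ.biUnion A := Finset.mem_biUnion.2 ⟨i, Finset.mem_univ _, ha⟩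
    have hbY : -b ∈ -(Finset.univ.biUnion B) := by
      rw [Finset.mem_neg', neg_neg]
      exact Finset.mem_biUnion.2 ⟨i, Finset.mem_univ _, hb⟩
    have hdX : b - a ∈ -(Finset.univ.biUnion fun i => A i - B i) := by
      rw [Finset.mem_neg', neg_sub]
      exact Finset.mem_biUnion.2 ⟨i, Finset.mem_univ _, Finset.sub_mem_sub ha hb⟩
    have k0 : a ∈ A' 0 := by_contra fun hc => h0 (Finset.mem_sdiff.2 ⟨haX, hc⟩)
    have k1 : -b ∈ A' 1 :=
      by_contra fun hc => h1 (Finset.mem_neg'.2 (Finset.mem_sdiff.2 ⟨hbY, hc⟩))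
    have k2 : b - a ∈ A' 2 := by_contra fun hc => h2 (Finset.mem_sdiff.2 ⟨hdX, hc⟩)
    refine hno ![a, -b, b - a] (Fintype.mem_piFinset.2 fun j => ?_) ?_
    · fin_cases j
      exacts [k0, k1, k2]
    · rw [Fin.sum_univ_three]
      show a + -b + (b - a) = 0
      abel
  have hblock : ∀ i, s * s ≤ s * (A i ∩ D₀).card + s * (B i ∩ -D₁).card + D₂.card := fun i => by
    have h := block_le (A i) (B i) D₀ (-D₁) D₂ (hW i) (htri i)
    rwa [(hcard i).1, (hcard i).2] at h
  -- disjoint blocks meet a set `D` in at most `|D|` elements altogether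
  have hsum : ∀ (C : Fin n → Finset G) (D : Finset G), (∀ i j, i ≠ j → Disjoint (C i) (C j)) →
      ∑ i, (C i ∩ D).card ≤ D.card := by
    intro C D hC
    have hdisj : (↑(Finset.univ : Finset (Fin n)) : Set (Fin n)).PairwiseDisjoint fun i => C i ∩ D :=
      fun i _ j _ hij => (hC i j hij).mono Finset.inter_subset_left Finset.inter_subset_left
    rw [← Finset.card_biUnion hdisj]
    exact Finset.card_le_card (Finset.biUnion_subset.2 fun i _ => Finset.inter_subset_right)
  have hsA := hsum A D₀ hdA
  have hsB := hsum B (-D₁) hdB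
  rw [Finset.card_neg] at hsB
  calc n * (s * s) = ∑ _i : Fin n, s * s := by
        rw [Finset.sum_const, Finset.card_univ, Fintype.card_fin, smul_eq_mul]
    _ ≤ ∑ i, (s * (A i ∩ D₀).card + s * (B i ∩ -D₁).card + D₂.card) :=
        Finset.sum_le_sum fun i _ => hblock i
    _ = s * ∑ i, (A i ∩ D₀).card + s * ∑ i, (B i ∩ -D₁).card + n * D₂.card := by
        rw [Finset.sum_add_distrib, Finset.sum_add_distrib, Finset.mul_sum, Finset.mul_sum,
          Finset.sum_const, Finset.card_univ, Fintype.card_fin, smul_eq_mul]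
    _ ≤ s * D₀.card + s * D₁.card + n * D₂.card :=
        Nat.add_le_add_right
          (Nat.add_le_add (Nat.mul_le_mul_left s hsA) (Nat.mul_le_mul_left s hsB)) _

end RemovalRegime

open RemovalRegime in
/-- **`RemovalRegime`** (settles `stmt-MatrixMultiplication-14314`, exact route signature
`Summit.MatrixMultiplication.MatrixMultiplication.Theses.FourierTwoFamiliesModP.RemovalRegime`): for all
`K` and `ε > 0` there is `s₀` such that every balanced SDPP family of `n` pairs of `s`-sets, `s ≥ s₀`,
`n ≤ K s`, in a finite abelian group `H` satisfies `n s ≤ ε |H|`.  Green's arithmetic removal lemma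
(`Green2005_1_5_holds`, `k = 3`) applied to `X`, `-Y`, `-X₀` with `η = ε / (2 + max K 0)`: the at most
`n s² ≤ |H| s ≤ δ |H|²` zero-sum triples (for `s ≥ 1/δ`) are all killed by deleting `≤ η |H|` points
from each set, but a deleted point kills at most `s`, `s`, resp. `n` of the `n s²` matched pairs. -/
theorem removalRegime_proof :
    Summit.MatrixMultiplication.MatrixMultiplication.Theses.FourierTwoFamiliesModP.RemovalRegime := by
  unfold Summit.MatrixMultiplication.MatrixMultiplication.Theses.FourierTwoFamiliesModP.RemovalRegime
  intro K ε hε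
  obtain ⟨K', hK'0, hKK'⟩ : ∃ K' : ℝ, 0 ≤ K' ∧ K ≤ K' := ⟨max K 0, le_max_right _ _, le_max_left _ _⟩
  have h2K' : (0 : ℝ) < 2 + K' := by linarith
  obtain ⟨η, hη, hηK⟩ : ∃ η : ℝ, 0 < η ∧ η * (2 + K') = ε :=
    ⟨ε / (2 + K'), div_pos hε h2K', by field_simp⟩
  obtain ⟨δ, hδ, hrem⟩ := Literature.Combinatorics.Additive.Green2005_1_5_holds 3 le_rfl η hη
  refine ⟨⌈1 / δ⌉₊ + 1, ?_⟩
  intro H _ _ n s A B hs hn hcard hW hX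
  classical
  have hs1 : 1 ≤ s := le_trans (Nat.le_add_left 1 _) hs
  have hA : ∀ i, (A i).card = s := fun i => (hcard i).1
  have hB : ∀ i, (B i).card = s := fun i => (hcard i).2
  have hAne : ∀ i, (A i).Nonempty := fun i => Finset.card_pos.1 ((hA i).symm ▸ hs1)
  have hBne : ∀ i, (B i).Nonempty := fun i => Finset.card_pos.1 ((hB i).symm ▸ hs1)
  have hSD : IsSDPP A B := ⟨hW, hX⟩
  have hdA : ∀ i j : Fin n, i ≠ j → Disjoint (A i) (A j) := fun i j hij =>
    disjoint_left_of_simultaneous hX hij (hBne j)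
  have hdB : ∀ i j : Fin n, i ≠ j → Disjoint (B i) (B j) := fun i j hij =>
    disjoint_right_of_simultaneous hX hij (hAne i)
  -- `n s ≤ |H|` (the `A i` are pairwise disjoint)
  have hns : n * s ≤ Fintype.card H := by
    have h := hSD.sum_card_left_le hBne
    simp only [hA, Finset.sum_const, Finset.card_univ, Fintype.card_fin, smul_eq_mul] at h
    exact h
  -- `n s² ≤ δ |H|²`
  have key : ((n * s : ℕ) : ℝ) * s ≤ (Fintype.card H : ℝ) * (δ * Fintype.card H) := by
    rcases Nat.eq_zero_or_pos n with rfl | hnpos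
    · simp only [zero_mul, Nat.cast_zero]
      exact mul_nonneg (Nat.cast_nonneg _) (mul_nonneg hδ.le (Nat.cast_nonneg _))
    · refine mul_le_mul (by exact_mod_cast hns) ?_ (Nat.cast_nonneg _) (Nat.cast_nonneg _)
      have hss : s * s ≤ Fintype.card H := by
        have h := card_mul_card_le_of_dpp (hW ⟨0, hnpos⟩)
        rwa [hA, hB] at h
      have hδs : (1 : ℝ) ≤ δ * s := by
        have h1 : (⌈1 / δ⌉₊ : ℝ) + 1 ≤ s := by exact_mod_cast hs
        have h2 : 1 / δ ≤ (⌈1 / δ⌉₊ : ℝ) := Nat.le_ceil _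
        have h3 : 1 / δ ≤ s := by linarith
        rw [div_le_iff₀ hδ] at h3
        linarith [mul_comm δ s]
      calc (s : ℝ) ≤ δ * s * s := le_mul_of_one_le_left (Nat.cast_nonneg _) hδs
        _ = δ * ((s * s : ℕ) : ℝ) := by push_cast; ring
        _ ≤ δ * Fintype.card H := mul_le_mul_of_nonneg_left (by exact_mod_cast hss) hδ.le
  obtain ⟨A', -, hdel, hno⟩ := hrem H
    ![Finset.univ.biUnion A, -(Finset.univ.biUnion B), -(Finset.univ.biUnion fun i => A i - B i)]
    (by
      calc (_ : ℝ) ≤ (((Finset.univ.biUnion fun i => A i ×ˢ B i).card : ℕ) : ℝ) :=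
            Nat.cast_le.2 (card_zeroSum_le_card_pairs A B hX)
        _ ≤ ((∑ i, (A i).card * (B i).card : ℕ) : ℝ) :=
            Nat.cast_le.2 (Finset.card_biUnion_le.trans_eq
              (Finset.sum_congr rfl fun i _ => Finset.card_product _ _))
        _ = ((n * s : ℕ) : ℝ) * s := by
            simp only [hA, hB, Finset.sum_const, Finset.card_univ, Fintype.card_fin, smul_eq_mul]
            push_cast
            ring
        _ ≤ (Fintype.card H : ℝ) * (δ * Fintype.card H) := key
        _ = δ * (Fintype.card H : ℝ) ^ (3 - 1) := by norm_num; ring)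
  have hd0 : (((Finset.univ.biUnion A \ A' 0).card : ℕ) : ℝ) ≤ η * Fintype.card H := by
    simpa only [Matrix.cons_val] using hdel 0
  have hd1 : ((((-(Finset.univ.biUnion B)) \ A' 1).card : ℕ) : ℝ) ≤ η * Fintype.card H := by
    simpa only [Matrix.cons_val] using hdel 1
  have hd2 : ((((-(Finset.univ.biUnion fun i => A i - B i)) \ A' 2).card : ℕ) : ℝ) ≤
      η * Fintype.card H := by
    simpa only [Matrix.cons_val] using hdel 2
  -- the bookkeeping, in `ℕ` then in `ℝ`
  have hnat := bookkeeping A B hcard hW hdA hdB A' hno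
  have hR : (n : ℝ) * (s * s) ≤ s * (η * Fintype.card H) + s * (η * Fintype.card H) +
      n * (η * Fintype.card H) := by
    have h := (Nat.cast_le (α := ℝ)).2 hnat
    push_cast at h
    have e0 := mul_le_mul_of_nonneg_left hd0 (Nat.cast_nonneg s)
    have e1 := mul_le_mul_of_nonneg_left hd1 (Nat.cast_nonneg s)
    have e2 := mul_le_mul_of_nonneg_left hd2 (Nat.cast_nonneg n)
    linarith
  have hηN : (0 : ℝ) ≤ η * Fintype.card H := mul_nonneg hη.le (Nat.cast_nonneg _)
  have hnK : (n : ℝ) ≤ K' * s := hn.trans (mul_le_mul_of_nonneg_right hKK' (Nat.cast_nonneg _))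
  have hspos : (0 : ℝ) < s := by exact_mod_cast hs1
  have hfin : (n : ℝ) * s * s ≤ ε * Fintype.card H * s := by
    calc (n : ℝ) * s * s = n * (s * s) := by ring
      _ ≤ s * (η * Fintype.card H) + s * (η * Fintype.card H) + n * (η * Fintype.card H) := hR
      _ ≤ s * (η * Fintype.card H) + s * (η * Fintype.card H) +
            (K' * s) * (η * Fintype.card H) := by
          have := mul_le_mul_of_nonneg_right hnK hηN
          linarith
      _ = (η * (2 + K')) * Fintype.card H * s := by ring
      _ = ε * Fintype.card H * s := by rw [hηK]
  exact le_of_mul_le_mul_right hfin hspos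

end Summit.MatrixMultiplication.MatrixMultiplication.Theorems
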